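/-
Copyright (c) 2026. All rights reserved.
Released under Apache 2.0 license as described in the file LICENSE.
Authors: abc-iut cell, statement-typer seat abc-iut-L4-t3 (wave 1).
-/
import Literature.AnabelianGeometry.AbsoluteAnabelian.LogFrobeniusCorollaries
import HarnessLib

/-!
# [AbsTopIII] Corollary 5.5 (ii), generators of the contact structure `ℋ_{An•}` (pinned)

S. Mochizuki, *Topics in absolute anabelian geometry III: global reconstruction algorithms*,
J. Math. Sci. Univ. Tokyo 22 (2015) 939–1156 [MochizukiAbsTopIII2015]; locators `p.N` = pages of the
author's manuscript (`paper:url-5493eb38cbb7`), read on the page: Cor 5.5 (ii) pp. 130–131.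

`LogFrobeniusCorollaries.lean` (seat abc-iut-L4-t3) typed Cor 5.5 (ii) as `Cor55Telecore`: the telecore `𝔗_{An•}` with its
edges `φ_⋏ = φ_{An•}` PINNED, admitting SOME contact structure — the generators were left TODO(general form). This file
PINS them: over a telecore `T` on the core of Cor 5.5 (i) (`n = 6`, core vertex `An•[𝒳]`) and a family of homotopies `ℋ`
on its underlying diagram `D_{An•}`, the predicate `IsAnContactGenerated T ℋ` records print's generators
`{η_{□⋎}, η_{□⋎}⁻¹, η_⋏, η_⋏⁻¹}`: "we write `η_{□⋎}` for the identity natural transformation from the arrow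
`φ_□ : An•[𝒳] → 𝒳` to the composite arrow `id_⋎ ∘ φ_⋎ : An•[𝒳] → 𝒳`" and "`η_⋏ : (D_{An•})_{[β¹_⋏]} ⥲ (D_{An•})_{[β⁰_⋏]}` for the
isomorphism arising from `η_{An•}`", `[β⁰_⋏]` "the path on `Γ⃗_{D_{An•}}` of length `0` at `⋏`" and `[β¹_⋏]` "some … path on
`Γ⃗_{D_{An•}}` of length `∈ {5, 6}` … that starts from `⋏`, descends via some path of length `∈ {4, 5}` to the core vertex
`An•[𝒳]`, and returns to `⋏` via the telecore edge `φ_⋏`"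
(both pairs in both orders are boundary pairs; the homotopies are the printed ones componentwise, through the
datum `lamOver` — "`λ⊞_{v,ν}` lies over `Th•[Z]`" — and `η_{An•}` of the setting; the boundary set is GENERATED by these pairs,
Def 3.5 (ii)); `Cor55TelecoreContact` = Cor 5.5 (ii) with the contact structure so pinned. This is the input the second
sentence of Cor 5.5 (iv) and the telecore clause of Cor 5.5 (vi) need (they remain TODO(general form)). Every `Prop` is an
ASSUMPTION on `L` asserted by the text for the genuine theaters. Refereed pre-IUT material; nothing here bears on [IUTchIII]
Cor. 3.12; typed ≠ discharged.
-/

set_option autoImplicit false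

universe u

open CategoryTheory Quiver

namespace Literature.AnabelianGeometry.AbsoluteAnabelian

namespace LogFrobeniusSetting

variable {Vmod : Type u} {isArc : Vmod → Bool} (L : LogFrobeniusSetting Vmod isArc)

/-- `D•_{≤5}`. [cite: MochizukiAbsTopIII2015, Cor 5.5 (ii) p. 130] -/
abbrev InFive : DVertex Vmod isArc → Prop := DVertex.InFirstRows (isArc := isArc) 5

/-- `□ ∈ D•_{≤5}`. [cite: MochizukiAbsTopIII2015, Cor 5.5 p. 130] -/
theorem core_mem_five : InFive (isArc := isArc) .core := ⟨trivial, Nat.le_of_ble_eq_true rfl⟩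

/-- `𝒳_n ∈ D•_{≤5}`. [cite: MochizukiAbsTopIII2015, Cor 5.5 p. 130] -/
theorem row1_mem_five (n : ℤ) : InFive (isArc := isArc) (.row1 n) := ⟨trivial, Nat.le_of_ble_eq_true rfl⟩

/-- `𝒩⊞_v ∈ D•_{≤5}`. [cite: MochizukiAbsTopIII2015, Cor 5.5 p. 130] -/
theorem nplus_mem_five (v : Vmod) : InFive (isArc := isArc) (.nplus v) := ⟨trivial, Nat.le_of_ble_eq_true rfl⟩

/-- `𝒩_v ∈ D•_{≤5}`. [cite: MochizukiAbsTopIII2015, Cor 5.5 p. 130] -/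
theorem nv_mem_five (v : Vmod) : InFive (isArc := isArc) (.nv v) := ⟨trivial, Nat.le_of_ble_eq_true rfl⟩

/-- `ℰ• ∈ D•_{≤5}` (row 5). [cite: MochizukiAbsTopIII2015, Cor 5.5 p. 130] -/
theorem e5_mem_five : InFive (isArc := isArc) .e5 := ⟨trivial, Nat.le_of_ble_eq_true rfl⟩

/-- the shape of the telecore `𝔗_{An•}`: `D•_{≤5}` extended by the core vertex `An•[𝒳]` with the arrows of `D•` into it as
observation edges and telecore edges `J`. [cite: MochizukiAbsTopIII2015, Cor 5.5 (ii) p. 130] -/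
abbrev anTelecoreShape (J : DSub (InFive (isArc := isArc)) → Type u) : ExtShape.{u} (DSub (InFive (isArc := isArc))) :=
  ⟨(obsShape (InFive (isArc := isArc)) DVertex.an).I, J⟩

/-- the underlying diagram of categories `D_{An•}` of the telecore, for telecore edges `J` realised by functors `tel`.
[cite: MochizukiAbsTopIII2015, Cor 5.5 (ii) p. 130] -/
abbrev anTelecoreDiagram (J : DSub (InFive (isArc := isArc)) → Type u)
    (tel : ∀ {a : DSub (InFive (isArc := isArc))}, J a → (L.An ⥤ a.1.category L)) :=
  (L.subdiagram InFive).extend (X := anTelecoreShape J) ⟨L.An, fun e => DEdge.functor L e, tel⟩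

section Paths

variable (J : DSub (InFive (isArc := isArc)) → Type u)

/-- the telecore edge `φ_□ : An•[𝒳] → □` as a path of length `1`. [cite: MochizukiAbsTopIII2015, Cor 5.5 (ii) p. 131] -/
def phiCorePath (j : J ⟨.core, core_mem_five⟩) :
    Path (anTelecoreShape J).obs ((anTelecoreShape J).base ⟨.core, core_mem_five⟩) :=
  Path.nil.cons j

/-- the path `[id_⋎] ∘ [φ_⋎]` of length `2` from `An•[𝒳]` to `□`. [cite: MochizukiAbsTopIII2015, Cor 5.5 (ii) p. 131] -/
def phiRowPath (n : ℤ) (j : J ⟨.row1 n, row1_mem_five n⟩) :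
    Path (anTelecoreShape J).obs ((anTelecoreShape J).base ⟨.core, core_mem_five⟩) :=
  (Path.nil.cons j).cons
    (show (anTelecoreShape J).base ⟨.row1 n, row1_mem_five n⟩ ⟶ (anTelecoreShape J).base ⟨.core, core_mem_five⟩
      from DEdge.toCore n)

/-- the descending path of length `4` from `□` to the core vertex through `λ⊞_{v,ν}`, `𝒩⊞_v → 𝒩_v → ℰ• → An•[𝒳]`.
[cite: MochizukiAbsTopIII2015, Cor 5.5 (ii) p. 131] -/
def descendPath (v : Vmod) (ν : LogVertex (isArc v)) (hν : ν.isPostLog = false) :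
    Path ((anTelecoreShape J).base ⟨.core, core_mem_five⟩) (anTelecoreShape J).obs :=
  ((((Path.nil.cons
      (show (anTelecoreShape J).base ⟨.core, core_mem_five⟩ ⟶ (anTelecoreShape J).base ⟨.nplus v, nplus_mem_five v⟩
        from DEdge.lam v ν hν)).cons
      (show (anTelecoreShape J).base ⟨.nplus v, nplus_mem_five v⟩ ⟶ (anTelecoreShape J).base ⟨.nv v, nv_mem_five v⟩
        from DEdge.forget v)).cons
      (show (anTelecoreShape J).base ⟨.nv v, nv_mem_five v⟩ ⟶ (anTelecoreShape J).base ⟨.e5, e5_mem_five⟩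
        from DEdge.toE v)).cons
      (show (anTelecoreShape J).base ⟨.e5, e5_mem_five⟩ ⟶ (anTelecoreShape J).obs from DEdge.κAn))

/-- `[β¹_□]`: descend from `□` and return via `φ_□` (length `5`). [cite: MochizukiAbsTopIII2015, Cor 5.5 (ii) p. 131] -/
def betaCorePath (v : Vmod) (ν : LogVertex (isArc v)) (hν : ν.isPostLog = false) (j : J ⟨.core, core_mem_five⟩) :
    Path ((anTelecoreShape J).base ⟨.core, core_mem_five⟩) ((anTelecoreShape J).base ⟨.core, core_mem_five⟩) :=
  (descendPath J v ν hν).cons j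

/-- `[β¹_⋎]`: from `𝒳_⋎` via `id_⋎` to `□`, descend, and return via `φ_⋎` (length `6`).
[cite: MochizukiAbsTopIII2015, Cor 5.5 (ii) p. 131] -/
def betaRowPath (n : ℤ) (v : Vmod) (ν : LogVertex (isArc v)) (hν : ν.isPostLog = false)
    (j : J ⟨.row1 n, row1_mem_five n⟩) :
    Path ((anTelecoreShape J).base ⟨.row1 n, row1_mem_five n⟩) ((anTelecoreShape J).base ⟨.row1 n, row1_mem_five n⟩) :=
  ((Path.nil.cons
      (show (anTelecoreShape J).base ⟨.row1 n, row1_mem_five n⟩ ⟶ (anTelecoreShape J).base ⟨.core, core_mem_five⟩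
        from DEdge.toCore n)).comp (descendPath J v ν hν)).cons j

end Paths

/-- **Cor 5.5 (ii), the generators of `ℋ_{An•}` PINNED**: for a telecore `T` (edges `J`, functors `T.telMap`) over the core of
(i) and a family of homotopies `ℋ` on `D_{An•}`: the boundary set of `ℋ` is generated (Def 3.5 (ii)) by the pairs
`([φ_□], [id_⋎] ∘ [φ_⋎])` (both orders; homotopy `η_{□⋎}` = the identity, componentwise) and, for each `⋏ ∈ L ∪ {□}` and each
telecore edge `φ_⋏`, the pairs `([β¹_⋏], [β⁰_⋏])` (both orders) for SOME descending path (a choice of `v`, `ν`), with homotopy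
`η_⋏` = "the isomorphism arising from `η_{An•}`" componentwise — i.e. `φ_{An•} κ_{An•}(λ⊞_{v,ν} lies over Th•[Z]) ≫ η_{An•}`.
[cite: MochizukiAbsTopIII2015, Cor 5.5 (ii) p. 131] -/
def IsAnContactGenerated {H hH}
    {hc : (DiagramOfCategories.Observable.mk (obsShape (InFive (isArc := isArc)) DVertex.an)
      (fun _ => (inferInstance : IsEmpty PEmpty.{u + 1})) (L.obsExt InFive .an) H hH).IsCore}
    (T : DiagramOfCategories.Telecore _ _ hc) (Hc : (L.anTelecoreDiagram T.J T.telMap).HomotopyFamily) : Prop :=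
  ∃ (vc : Vmod) (νc : LogVertex (isArc vc)) (hνc : νc.isPostLog = false)
    (vr : ℤ → Vmod) (νr : ∀ n, LogVertex (isArc (vr n))) (hνr : ∀ n, (νr n).isPostLog = false),
    -- generation of the boundary set
    DiagramOfCategories.HomotopyFamily.IsGeneratedBy _ Hc (fun ⦃a b⦄ p q =>
      (∃ (n : ℤ) (jc : T.J ⟨.core, core_mem_five⟩) (jn : T.J ⟨.row1 n, row1_mem_five n⟩) (_ : a = (anTelecoreShape T.J).obs)
          (_ : b = (anTelecoreShape T.J).base ⟨.core, core_mem_five⟩),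
        (HEq p (phiCorePath T.J jc) ∧ HEq q (phiRowPath T.J n jn)) ∨
          (HEq p (phiRowPath T.J n jn) ∧ HEq q (phiCorePath T.J jc))) ∨
      (∃ (jc : T.J ⟨.core, core_mem_five⟩) (_ : a = (anTelecoreShape T.J).base ⟨.core, core_mem_five⟩) (_ : b = a),
        (HEq p (betaCorePath T.J vc νc hνc jc) ∧ HEq q (Path.nil : Path a a)) ∨
          (HEq p (Path.nil : Path a a) ∧ HEq q (betaCorePath T.J vc νc hνc jc))) ∨
      (∃ (n : ℤ) (jn : T.J ⟨.row1 n, row1_mem_five n⟩) (_ : a = (anTelecoreShape T.J).base ⟨.row1 n, row1_mem_five n⟩)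
          (_ : b = a),
        (HEq p (betaRowPath T.J n (vr n) (νr n) (hνr n) jn) ∧ HEq q (Path.nil : Path a a)) ∨
          (HEq p (Path.nil : Path a a) ∧ HEq q (betaRowPath T.J n (vr n) (νr n) (hνr n) jn)))) ∧
    -- `η_{□⋎}` is the identity natural transformation (componentwise)
    (∀ (n : ℤ) (jc : T.J ⟨.core, core_mem_five⟩) (jn : T.J ⟨.row1 n, row1_mem_five n⟩)
        (hmem : Hc.E (phiCorePath T.J jc) (phiRowPath T.J n jn)) (A : L.An),
      ∃ h, (Hc.η hmem).app A = eqToHom h) ∧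
    -- `η_□` arises from `η_{An•}` (componentwise)
    (∀ (jc : T.J ⟨.core, core_mem_five⟩) (hmem : Hc.E (betaCorePath T.J vc νc hνc jc) Path.nil) (X₀ : L.X),
      ∃ (h₁ : ((L.anTelecoreDiagram T.J T.telMap).pathFunctor (betaCorePath T.J vc νc hνc jc)).obj X₀ =
          L.φAn.obj (L.κAn.functor.obj ((L.lam vc νc ⋙ L.forget vc ⋙ L.toE vc).obj X₀)))
        (h₂ : X₀ = ((L.anTelecoreDiagram T.J T.telMap).pathFunctor (Path.nil :
          Path ((anTelecoreShape T.J).base ⟨.core, core_mem_five⟩) _)).obj X₀),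
        (Hc.η hmem).app X₀ =
          eqToHom h₁ ≫ L.φAn.map (L.κAn.functor.map ((L.lamOver vc νc).hom.app X₀)) ≫ L.ηAn.hom.app X₀ ≫ eqToHom h₂) ∧
    -- `η_⋎` arises from `η_{An•}` (componentwise)
    (∀ (n : ℤ) (jn : T.J ⟨.row1 n, row1_mem_five n⟩)
        (hmem : Hc.E (betaRowPath T.J n (vr n) (νr n) (hνr n) jn) Path.nil) (X₀ : L.X),
      ∃ (h₁ : ((L.anTelecoreDiagram T.J T.telMap).pathFunctor (betaRowPath T.J n (vr n) (νr n) (hνr n) jn)).obj X₀ =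
          L.φAn.obj (L.κAn.functor.obj ((L.lam (vr n) (νr n) ⋙ L.forget (vr n) ⋙ L.toE (vr n)).obj X₀)))
        (h₂ : X₀ = ((L.anTelecoreDiagram T.J T.telMap).pathFunctor (Path.nil :
          Path ((anTelecoreShape T.J).base ⟨.row1 n, row1_mem_five n⟩) _)).obj X₀),
        (Hc.η hmem).app X₀ =
          eqToHom h₁ ≫ L.φAn.map (L.κAn.functor.map ((L.lamOver (vr n) (νr n)).hom.app X₀)) ≫ L.ηAn.hom.app X₀ ≫
            eqToHom h₂)

/-- **Cor 5.5 (ii) with the contact structure PINNED** (assumption on `L`): `φ_{An•}` gives a telecore `𝔗_{An•}` on `D•_{≤5}`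
over the core `An•[𝒳]` of (i), with telecore edges `φ_⋏ = φ_{An•}` (`⋏ ∈ L ∪ {□}`), and "the collection of natural
transformations `{η_{□⋎}, η_{□⋎}⁻¹, η_⋏, η_⋏⁻¹}` … generate a contact structure `ℋ_{An•}` on the telecore `𝔗_{An•}`".
[cite: MochizukiAbsTopIII2015, Cor 5.5 (ii) pp. 130–131] -/
def Cor55TelecoreContact : Prop :=
  ∃ (H : ((L.subdiagram (InFive (isArc := isArc))).extend (L.obsExt InFive .an)).HomotopyFamily)
    (hH : ∀ ⦃a b : (obsShape (InFive (isArc := isArc)) DVertex.an).Vertex⦄ ⦃p q : Path a b⦄,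
      H.E p q → b = (obsShape (InFive (isArc := isArc)) DVertex.an).obs)
    (hc : (DiagramOfCategories.Observable.mk _ (fun _ => (inferInstance : IsEmpty PEmpty.{u + 1})) _ H hH).IsCore)
    (T : DiagramOfCategories.Telecore _ _ hc),
    T.J = (fun a => TelecoreIdx a.1) ∧
      HEq (fun (a : DSub (InFive (isArc := isArc))) (j : T.J a) => T.telMap j)
        (fun (a : DSub (InFive (isArc := isArc))) (j : TelecoreIdx a.1) => L.telecoreFun a.1 j) ∧
      ∃ Hc, DiagramOfCategories.Telecore.IsContactStructure _ T Hc ∧ L.IsAnContactGenerated T Hc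

/-- the pinned form refines `Cor55Telecore` of `LogFrobeniusCorollaries.lean`. [cite: MochizukiAbsTopIII2015, Cor 5.5 (ii) p. 131] -/
theorem cor55Telecore_of_contact (h : L.Cor55TelecoreContact) : L.Cor55Telecore := by
  obtain ⟨H, hH, hc, T, hJ, htel, Hc, hHc, -⟩ := h
  exact ⟨H, hH, hc, T, hJ, htel, Hc, hHc⟩

end LogFrobeniusSetting

end Literature.AnabelianGeometry.AbsoluteAnabelian
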